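import Summits.CriticalPhenomena.PercolationContinuityZ3.Theorems.PercNearOneGluingAdditiveGluingSwitchClosure
import Summits.CriticalPhenomena.PercolationContinuityZ3.Theorems.PercNearOneGluingAdditiveGluingCone7Assembly
import Summits.CriticalPhenomena.PercolationContinuityZ3.Theorems.PercNearOneGluingAdditiveGluingIsolatedBlock
import HarnessLib

/-! # Crux `PercNearOneGluing.AdditiveGluing` (stmt-CriticalPhenomena-4576) — reduction of the crux to a certificate on the
# GLUED-DOMINANT-MINIMISER class (exchange-certificate form, seat (d) round 3)

Support file (`--supports stmt-CriticalPhenomena-4576`); no definitions, no named facts.  CONDITIONAL result (hypothesis spelled out).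

The v8 skeleton closes the crux from the cone statement (`stub_cone7Assembly_c5`) and the cone statement from the bystander kernel plus an
existential single-bystander certificate for EVERY block (`stub_bystanderCert_c5`).  With the landed case lemmas the certificate is only
needed on a thin residual class.  `cone7_of_gdmCert` proves the cone statement (block goodness of every non-relay block `S` at the un-glued
minimiser `a₀`, given `HBLK`) by the case split
* isolated block — `stub_isolatedBlock_c5`;
* LEAF: some `v ∈ S` with `τ_u(v) ≥ τ_u(a₀)` — `blockGood_of_leaf` (Kozma–Nitzan Lemma 5 in block form);
* SWITCH: some bystander `x' ∈ S` with a positive edge and some minimiser `d` of `τ_{u−x'}` with `τ_{u/S}(a₀) ≤ τ_{u/S}(d)` —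
  `blockGood_of_switch` (down-set of good designations);
* otherwise (the GLUED-DOMINANT MINIMISER class, GDM: `S` bad and `a₀` glued-strictly-above every single-deletion minimiser) — the
  hypothesis `GDMCERT`: a per-layer exchange certificate CERT⁺⁺⁺ for SOME bystander, discharged by `bystanderKernel3`.
`additiveGluing_of_gdmCert : GDMCERT → AdditiveGluing` (statement unfolded, via `stub_cone7Assembly_c5`).  Census of this seat (exact
engine, random weighted graphs n ≤ 8): GDM occurs in ≈ 1–2 of 10⁴ drift instances; in every GDM instance found (random, annealed, and the
lead-c5 all-drift witness) the certificate exists for EVERY bystander.  [cite: KozmaNitzan2024, §3.2 Thms 4–5 pp. 12–14, Question 9 p. 36]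
-/

namespace Summit.CriticalPhenomena.PercolationContinuityZ3.Theorems

open MeasureTheory Set
open Literature.Probability.LatticeModels (prodBernoulli)
open Literature.Probability.Percolation (BondConfig openConn openConnIn openGraph openCluster)
open scoped BigOperators

noncomputable section
open Classical

section GDMReduction

open Literature.Probability.LatticeModels Literature.Probability.Percolation

variable {n : ℕ}

/-- **LEAF case (worst selection)**: if some vertex `v` of the block is at least as reliable as the designation `a₀`, the block is
`a₀`-good — Kozma–Nitzan's Lemma 5 in block form (`stub_gluingLemma5`), pockets being non-negative.
[cite: KozmaNitzan2024, Lemma 5 p. 13] -/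
theorem blockGood_of_leaf (u : Sym2 (Fin n) → unitInterval) (A S : Finset (Fin n)) (b a₀ v : Fin n) (hb : b ∈ A)
    (hv : v ∈ S) (hbS : b ∉ S)
    (hle : (prodBernoulli u).real (openConn a₀ b) ≤ (prodBernoulli u).real (openConn v b)) :
    (prodBernoulli u).real (openConn a₀ b)
          + (prodBernoulli u).real
              ((openConn a₀ b)ᶜ ∩ (⋃ v ∈ S, openConn a₀ v) ∩ (⋃ v ∈ S, openConn v b))
        ≤ (prodBernoulli u).real (⋃ v ∈ S, openConn v b)
          + (∑ W ∈ (Finset.univ : Finset (Finset (Fin n))).filter (fun W => Disjoint W A),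
              (prodBernoulli u).real
                  {ω : BondConfig (Fin n) | ∀ z : Fin n, (z ∈ W ↔ ω ∈ ⋃ v ∈ S, openConn v z)}
                * A.inf' ⟨b, hb⟩ (fun a => (prodBernoulli u).real (openConnIn ((W : Set (Fin n))ᶜ) a b))) := by
  have h5 := stub_gluingLemma5 n u S a₀ v b hv hbS hle
  rw [blockGrowth_glue_real_openConn, blockGrowth_glue_real_iUnion] at h5
  have hpk : 0 ≤ (∑ W ∈ (Finset.univ : Finset (Finset (Fin n))).filter (fun W => Disjoint W A),
              (prodBernoulli u).real
                  {ω : BondConfig (Fin n) | ∀ z : Fin n, (z ∈ W ↔ ω ∈ ⋃ v ∈ S, openConn v z)}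
                * A.inf' ⟨b, hb⟩ (fun a => (prodBernoulli u).real (openConnIn ((W : Set (Fin n))ᶜ) a b))) :=
    Finset.sum_nonneg fun W _ => mul_nonneg measureReal_nonneg (Finset.le_inf' _ _ fun a _ => measureReal_nonneg)
  linarith

/-- **The cone statement from a certificate on the GDM class.**  See the module docstring for the case split.
[cite: KozmaNitzan2024, §3.2 Thms 4–5 pp. 12–14] -/
theorem cone7_of_gdmCert
    (hG : (∀ (n : ℕ) (u : Sym2 (Fin n) → unitInterval) (A S : Finset (Fin n)) (b a₀ : Fin n) (hb : b ∈ A),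
      Disjoint S A → a₀ ∈ A →
      (∀ a ∈ A, (prodBernoulli u).real (openConn a₀ b) ≤ (prodBernoulli u).real (openConn a b)) →
      (∀ w' : Sym2 (Fin n) → unitInterval,
        (Finset.univ.filter (fun v : Fin n => ∃ y : Fin n, 0 < (w' s(y, v) : ℝ))).card
          < (Finset.univ.filter (fun v : Fin n => ∃ y : Fin n, 0 < (u s(y, v) : ℝ))).card →
        ∀ (A' S' : Finset (Fin n)) (b' d' : Fin n) (hb' : b' ∈ A'), Disjoint S' A' → d' ∈ A' →
        (∀ a ∈ A', (prodBernoulli w').real (openConn d' b') ≤ (prodBernoulli w').real (openConn a b')) →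
        (prodBernoulli w').real (openConn d' b')
          + (prodBernoulli w').real
              ((openConn d' b')ᶜ ∩ (⋃ v ∈ S', openConn d' v) ∩ (⋃ v ∈ S', openConn v b'))
        ≤ (prodBernoulli w').real (⋃ v ∈ S', openConn v b')
          + (∑ W ∈ (Finset.univ : Finset (Finset (Fin n))).filter (fun W => Disjoint W A'),
              (prodBernoulli w').real
                  {ω : BondConfig (Fin n) | ∀ z : Fin n, (z ∈ W ↔ ω ∈ ⋃ v ∈ S', openConn v z)}
                * A'.inf' ⟨b', hb'⟩ (fun a => (prodBernoulli w').real (openConnIn ((W : Set (Fin n))ᶜ) a b')))) →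
      (∃ x ∈ S, ∃ y : Fin n, (u s(x, y) : ℝ) ≠ 0) →
      (∀ v ∈ S, (prodBernoulli u).real (openConn v b) < (prodBernoulli u).real (openConn a₀ b)) →
      (∀ x' ∈ S, (∃ y : Fin n, (u s(x', y) : ℝ) ≠ 0) → ∀ dd ∈ A,
        (∀ a ∈ A, (prodBernoulli (fun e : Sym2 (Fin n) => if (∃ y ∈ e, y ∈ ({x'} : Finset (Fin n))) then (0 : unitInterval) else u e)).real (openConn dd b) ≤ (prodBernoulli (fun e : Sym2 (Fin n) => if (∃ y ∈ e, y ∈ ({x'} : Finset (Fin n))) then (0 : unitInterval) else u e)).real (openConn a b)) →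
        (prodBernoulli (fun e : Sym2 (Fin n) => if (∀ y ∈ e, y ∈ S) ∧ ¬ e.IsDiag then 1 else u e)).real (openConn dd b) < (prodBernoulli (fun e : Sym2 (Fin n) => if (∀ y ∈ e, y ∈ S) ∧ ¬ e.IsDiag then 1 else u e)).real (openConn a₀ b)) →
      ∃ x' ∈ S, ∃ (d : Finset (Fin n) → Fin n) (w : Finset (Fin n) → Sym2 (Fin n) → unitInterval) (modeB : Finset (Fin n) → Bool),
      (∀ B : Finset (Fin n), d B ∈ A) ∧
      (∀ B : Finset (Fin n), Disjoint (S.erase x' ∪ B) A → (prodBernoulli u).real {ω : BondConfig (Fin n) | ∀ y : Fin n, y ∈ B ↔ (y ∉ ({x'} : Finset (Fin n)) ∧ ∃ o ∈ ({x'} : Finset (Fin n)), s(o, y) ∈ ω)} ≠ 0 →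
        ∀ a ∈ A, (prodBernoulli (w B)).real (openConn (d B) b) ≤ (prodBernoulli (w B)).real (openConn a b)) ∧
      (∀ B : Finset (Fin n), Disjoint (S.erase x' ∪ B) A → (prodBernoulli u).real {ω : BondConfig (Fin n) | ∀ y : Fin n, y ∈ B ↔ (y ∉ ({x'} : Finset (Fin n)) ∧ ∃ o ∈ ({x'} : Finset (Fin n)), s(o, y) ∈ ω)} ≠ 0 →
        (Finset.univ.filter (fun v : Fin n => ∃ y : Fin n, 0 < (w B s(y, v) : ℝ))).card
          < (Finset.univ.filter (fun v : Fin n => ∃ y : Fin n, 0 < (u s(y, v) : ℝ))).card) ∧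
      (∀ B : Finset (Fin n), Disjoint (S.erase x' ∪ B) A → (prodBernoulli u).real {ω : BondConfig (Fin n) | ∀ y : Fin n, y ∈ B ↔ (y ∉ ({x'} : Finset (Fin n)) ∧ ∃ o ∈ ({x'} : Finset (Fin n)), s(o, y) ∈ ω)} ≠ 0 → ∀ e : Sym2 (Fin n),
        ¬ ((∀ y ∈ e, y ∈ (S.erase x' ∪ B)) ∧ ¬ e.IsDiag) → ¬ (d B ∈ e ∧ ∃ y ∈ e, y ∈ (S.erase x' ∪ B)) →
        w B e = (if modeB B = true then (fun e : Sym2 (Fin n) => if a₀ ∈ e ∧ (∃ y ∈ e, y ∈ (S.erase x' ∪ B)) then (0 : unitInterval) else if (∀ y ∈ e, y ∈ B) ∧ ¬ e.IsDiag then 1 else if (∃ y ∈ e, y ∈ ({x'} : Finset (Fin n))) then 0 else u e) e else (fun e : Sym2 (Fin n) => if (∀ y ∈ e, y ∈ B) ∧ ¬ e.IsDiag then 1 else if (∃ y ∈ e, y ∈ ({x'} : Finset (Fin n))) then 0 else u e) e)) ∧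
      (∀ B : Finset (Fin n), Disjoint (S.erase x' ∪ B) A → (prodBernoulli u).real {ω : BondConfig (Fin n) | ∀ y : Fin n, y ∈ B ↔ (y ∉ ({x'} : Finset (Fin n)) ∧ ∃ o ∈ ({x'} : Finset (Fin n)), s(o, y) ∈ ω)} ≠ 0 →
        0 < (prodBernoulli (w B)).real {ω : BondConfig (Fin n) | ∀ y ∈ (S.erase x' ∪ B), s(d B, y) ∉ ω}) ∧
      0 ≤ ∑ B : Finset (Fin n), (prodBernoulli u).real {ω : BondConfig (Fin n) | ∀ y : Fin n, y ∈ B ↔ (y ∉ ({x'} : Finset (Fin n)) ∧ ∃ o ∈ ({x'} : Finset (Fin n)), s(o, y) ∈ ω)}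
          * (if Disjoint (S.erase x' ∪ B) A then
              (if modeB B = true then
                  (prodBernoulli (fun e : Sym2 (Fin n) => if (∀ y ∈ e, y ∈ B) ∧ ¬ e.IsDiag then 1 else if (∃ y ∈ e, y ∈ ({x'} : Finset (Fin n))) then 0 else u e)).real {ω : BondConfig (Fin n) | ∀ y ∈ (S.erase x' ∪ B), s(a₀, y) ∉ ω}
                    * (((prodBernoulli (fun e : Sym2 (Fin n) => if a₀ ∈ e ∧ (∃ y ∈ e, y ∈ (S.erase x' ∪ B)) then (0 : unitInterval) else if (∀ y ∈ e, y ∈ B) ∧ ¬ e.IsDiag then 1 else if (∃ y ∈ e, y ∈ ({x'} : Finset (Fin n))) then 0 else u e)).real (openConn (d B) b) + (prodBernoulli (fun e : Sym2 (Fin n) => if a₀ ∈ e ∧ (∃ y ∈ e, y ∈ (S.erase x' ∪ B)) then (0 : unitInterval) else if (∀ y ∈ e, y ∈ B) ∧ ¬ e.IsDiag then 1 else if (∃ y ∈ e, y ∈ ({x'} : Finset (Fin n))) then 0 else u e)).real ((openConn (d B) b)ᶜ ∩ (⋃ v ∈ (S.erase x' ∪ B), openConn (d B) v) ∩ (⋃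 v ∈ (S.erase x' ∪ B), openConn v b)))
                       - ((prodBernoulli (fun e : Sym2 (Fin n) => if a₀ ∈ e ∧ (∃ y ∈ e, y ∈ (S.erase x' ∪ B)) then (0 : unitInterval) else if (∀ y ∈ e, y ∈ B) ∧ ¬ e.IsDiag then 1 else if (∃ y ∈ e, y ∈ ({x'} : Finset (Fin n))) then 0 else u e)).real (openConn a₀ b) + (prodBernoulli (fun e : Sym2 (Fin n) => if a₀ ∈ e ∧ (∃ y ∈ e, y ∈ (S.erase x' ∪ B)) then (0 : unitInterval) else if (∀ y ∈ e, y ∈ B) ∧ ¬ e.IsDiag then 1 else if (∃ y ∈ e, y ∈ ({x'} : Finset (Fin n))) then 0 else u e)).real ((openConn a₀ b)ᶜ ∩ (⋃ v ∈ (S.erase x' ∪ B), openConn a₀ v) ∩ (⋃ v ∈ (S.erase x' ∪ B), openConn v b))))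
                else (((prodBernoulli (fun e : Sym2 (Fin n) => if (∀ y ∈ e, y ∈ B) ∧ ¬ e.IsDiag then 1 else if (∃ y ∈ e, y ∈ ({x'} : Finset (Fin n))) then 0 else u e)).real (openConn (d B) b) + (prodBernoulli (fun e : Sym2 (Fin n) => if (∀ y ∈ e, y ∈ B) ∧ ¬ e.IsDiag then 1 else if (∃ y ∈ e, y ∈ ({x'} : Finset (Fin n))) then 0 else u e)).real ((openConn (d B) b)ᶜ ∩ (⋃ v ∈ (S.erase x' ∪ B), openConn (d B) v) ∩ (⋃ v ∈ (S.erase x' ∪ B), openConn v b)))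
                       - ((prodBernoulli (fun e : Sym2 (Fin n) => if (∀ y ∈ e, y ∈ B) ∧ ¬ e.IsDiag then 1 else if (∃ y ∈ e, y ∈ ({x'} : Finset (Fin n))) then 0 else u e)).real (openConn a₀ b) + (prodBernoulli (fun e : Sym2 (Fin n) => if (∀ y ∈ e, y ∈ B) ∧ ¬ e.IsDiag then 1 else if (∃ y ∈ e, y ∈ ({x'} : Finset (Fin n))) then 0 else u e)).real ((openConn a₀ b)ᶜ ∩ (⋃ v ∈ (S.erase x' ∪ B), openConn a₀ v) ∩ (⋃ v ∈ (S.erase x' ∪ B), openConn v b)))))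
            else
              ((prodBernoulli (fun e : Sym2 (Fin n) => if (∀ y ∈ e, y ∈ B) ∧ ¬ e.IsDiag then 1 else if (∃ y ∈ e, y ∈ ({x'} : Finset (Fin n))) then 0 else u e)).real (⋃ v ∈ (S.erase x' ∪ B), openConn v b)
                - ((prodBernoulli (fun e : Sym2 (Fin n) => if (∀ y ∈ e, y ∈ B) ∧ ¬ e.IsDiag then 1 else if (∃ y ∈ e, y ∈ ({x'} : Finset (Fin n))) then 0 else u e)).real (openConn a₀ b) + (prodBernoulli (fun e : Sym2 (Fin n) => if (∀ y ∈ e, y ∈ B) ∧ ¬ e.IsDiag then 1 else if (∃ y ∈ e, y ∈ ({x'} : Finset (Fin n))) then 0 else u e)).real ((openConn a₀ b)ᶜ ∩ (⋃ v ∈ (S.erase x' ∪ B), openConn a₀ v) ∩ (⋃ v ∈ (S.erase x' ∪ B), openConn v b))))))) :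
    ∀ (n : ℕ) (u : Sym2 (Fin n) → unitInterval) (A S : Finset (Fin n)) (b a₀ : Fin n) (hb : b ∈ A),
      Disjoint S A → a₀ ∈ A →
      (∀ a ∈ A, (prodBernoulli u).real (openConn a₀ b) ≤ (prodBernoulli u).real (openConn a b)) →
      (∀ w' : Sym2 (Fin n) → unitInterval,
        (Finset.univ.filter (fun v : Fin n => ∃ y : Fin n, 0 < (w' s(y, v) : ℝ))).card
          < (Finset.univ.filter (fun v : Fin n => ∃ y : Fin n, 0 < (u s(y, v) : ℝ))).card →
        ∀ (A' S' : Finset (Fin n)) (b' d' : Fin n) (hb' : b' ∈ A'), Disjoint S' A' → d' ∈ A' →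
        (∀ a ∈ A', (prodBernoulli w').real (openConn d' b') ≤ (prodBernoulli w').real (openConn a b')) →
        (prodBernoulli w').real (openConn d' b')
          + (prodBernoulli w').real
              ((openConn d' b')ᶜ ∩ (⋃ v ∈ S', openConn d' v) ∩ (⋃ v ∈ S', openConn v b'))
        ≤ (prodBernoulli w').real (⋃ v ∈ S', openConn v b')
          + (∑ W ∈ (Finset.univ : Finset (Finset (Fin n))).filter (fun W => Disjoint W A'),
              (prodBernoulli w').real
                  {ω : BondConfig (Fin n) | ∀ z : Fin n, (z ∈ W ↔ ω ∈ ⋃ v ∈ S', openConn v z)}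
                * A'.inf' ⟨b', hb'⟩ (fun a => (prodBernoulli w').real (openConnIn ((W : Set (Fin n))ᶜ) a b')))) →
      (prodBernoulli u).real (openConn a₀ b)
          + (prodBernoulli u).real
              ((openConn a₀ b)ᶜ ∩ (⋃ v ∈ S, openConn a₀ v) ∩ (⋃ v ∈ S, openConn v b))
        ≤ (prodBernoulli u).real (⋃ v ∈ S, openConn v b)
          + (∑ W ∈ (Finset.univ : Finset (Finset (Fin n))).filter (fun W => Disjoint W A),
              (prodBernoulli u).real
                  {ω : BondConfig (Fin n) | ∀ z : Fin n, (z ∈ W ↔ ω ∈ ⋃ v ∈ S, openConn v z)}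
                * A.inf' ⟨b, hb⟩ (fun a => (prodBernoulli u).real (openConnIn ((W : Set (Fin n))ᶜ) a b))) := by
  intro n u A S b a₀ hb hSA ha₀ hmin hblk
  have hbS : b ∉ S := fun h => Finset.disjoint_left.1 hSA h hb
  -- isolated block
  by_cases hiso : ∀ v ∈ S, ∀ y : Fin n, (u s(y, v) : ℝ) = 0
  · exact stub_isolatedBlock_c5 n u A S b a₀ hb hSA ha₀ hmin hiso
  have hex : ∃ x ∈ S, ∃ y : Fin n, (u s(x, y) : ℝ) ≠ 0 := by
    push Not at hiso
    obtain ⟨v, hv, y, hy⟩ := hiso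
    refine ⟨v, hv, y, ?_⟩
    rw [Sym2.eq_swap]
    exact hy
  -- leaf
  by_cases hleaf : ∃ v ∈ S, (prodBernoulli u).real (openConn a₀ b) ≤ (prodBernoulli u).real (openConn v b)
  · obtain ⟨v, hv, hle⟩ := hleaf
    exact blockGood_of_leaf u A S b a₀ v hb hv hbS hle
  -- switch
  by_cases hsw : ∃ x' ∈ S, (∃ y : Fin n, (u s(x', y) : ℝ) ≠ 0) ∧ ∃ d ∈ A,
      (∀ a ∈ A, (prodBernoulli (fun e : Sym2 (Fin n) => if (∃ y ∈ e, y ∈ ({x'} : Finset (Fin n))) then (0 : unitInterval) else u e)).real (openConn d b) ≤ (prodBernoulli (fun e : Sym2 (Fin n) => if (∃ y ∈ e, y ∈ ({x'} : Finset (Fin n))) then (0 : unitInterval) else u e)).real (openConn a b)) ∧ (prodBernoulli (fun e : Sym2 (Fin n) => if (∀ y ∈ e, y ∈ S) ∧ ¬ e.IsDiag then 1 else u e)).real (openConn a₀ b) ≤ (prodBernoulli (fun e : Sym2 (Fin n) => if (∀ y ∈ e, y ∈ S) ∧ ¬ e.IsDiag then 1 else u e)).real (openConn d b)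
  · obtain ⟨x', hx', hy, d, hd, hdmin, hle⟩ := hsw
    exact blockGood_of_switch u A S b a₀ x' d hb hSA hx' hd hy hdmin hle hblk
  -- the glued-dominant-minimiser class: use the certificate
  have hbad : ∀ v ∈ S, (prodBernoulli u).real (openConn v b) < (prodBernoulli u).real (openConn a₀ b) := by
    intro v hv
    by_contra h
    exact hleaf ⟨v, hv, not_lt.1 h⟩
  have hgdm : ∀ x' ∈ S, (∃ y : Fin n, (u s(x', y) : ℝ) ≠ 0) → ∀ dd ∈ A,
      (∀ a ∈ A, (prodBernoulli (fun e : Sym2 (Fin n) => if (∃ y ∈ e, y ∈ ({x'} : Finset (Fin n))) then (0 : unitInterval) else u e)).real (openConn dd b)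
        ≤ (prodBernoulli (fun e : Sym2 (Fin n) => if (∃ y ∈ e, y ∈ ({x'} : Finset (Fin n))) then (0 : unitInterval) else u e)).real (openConn a b)) →
      (prodBernoulli (fun e : Sym2 (Fin n) => if (∀ y ∈ e, y ∈ S) ∧ ¬ e.IsDiag then 1 else u e)).real (openConn dd b)
        < (prodBernoulli (fun e : Sym2 (Fin n) => if (∀ y ∈ e, y ∈ S) ∧ ¬ e.IsDiag then 1 else u e)).real (openConn a₀ b) := by
    intro x' hx' hy dd hdd hddmin
    by_contra h
    exact hsw ⟨x', hx', hy, dd, hdd, hddmin, not_lt.1 h⟩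
  obtain ⟨x', hx', d, w, modeB, hdA, hwmin, hwcard, hwagree, hwpos, hsum⟩ :=
    hG n u A S b a₀ hb hSA ha₀ hmin hblk hex hbad hgdm
  exact bystanderKernel3 n u A S b a₀ x' hb d w modeB hSA ha₀ hx' hmin hdA hwmin hwcard hwagree hwpos hblk hsum

/-- **`AdditiveGluing` from a certificate on the GDM class** (statement of the crux unfolded; composition with the landed assembly
`stub_cone7Assembly_c5`).  [cite: KozmaNitzan2024, §3.2 pp. 12–14] -/
theorem additiveGluing_of_gdmCert
    (hG : (∀ (n : ℕ) (u : Sym2 (Fin n) → unitInterval) (A S : Finset (Fin n)) (b a₀ : Fin n) (hb : b ∈ A),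
      Disjoint S A → a₀ ∈ A →
      (∀ a ∈ A, (prodBernoulli u).real (openConn a₀ b) ≤ (prodBernoulli u).real (openConn a b)) →
      (∀ w' : Sym2 (Fin n) → unitInterval,
        (Finset.univ.filter (fun v : Fin n => ∃ y : Fin n, 0 < (w' s(y, v) : ℝ))).card
          < (Finset.univ.filter (fun v : Fin n => ∃ y : Fin n, 0 < (u s(y, v) : ℝ))).card →
        ∀ (A' S' : Finset (Fin n)) (b' d' : Fin n) (hb' : b' ∈ A'), Disjoint S' A' → d' ∈ A' →
        (∀ a ∈ A', (prodBernoulli w').real (openConn d' b') ≤ (prodBernoulli w').real (openConn a b')) →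
        (prodBernoulli w').real (openConn d' b')
          + (prodBernoulli w').real
              ((openConn d' b')ᶜ ∩ (⋃ v ∈ S', openConn d' v) ∩ (⋃ v ∈ S', openConn v b'))
        ≤ (prodBernoulli w').real (⋃ v ∈ S', openConn v b')
          + (∑ W ∈ (Finset.univ : Finset (Finset (Fin n))).filter (fun W => Disjoint W A'),
              (prodBernoulli w').real
                  {ω : BondConfig (Fin n) | ∀ z : Fin n, (z ∈ W ↔ ω ∈ ⋃ v ∈ S', openConn v z)}
                * A'.inf' ⟨b', hb'⟩ (fun a => (prodBernoulli w').real (openConnIn ((W : Set (Fin n))ᶜ) a b')))) →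
      (∃ x ∈ S, ∃ y : Fin n, (u s(x, y) : ℝ) ≠ 0) →
      (∀ v ∈ S, (prodBernoulli u).real (openConn v b) < (prodBernoulli u).real (openConn a₀ b)) →
      (∀ x' ∈ S, (∃ y : Fin n, (u s(x', y) : ℝ) ≠ 0) → ∀ dd ∈ A,
        (∀ a ∈ A, (prodBernoulli (fun e : Sym2 (Fin n) => if (∃ y ∈ e, y ∈ ({x'} : Finset (Fin n))) then (0 : unitInterval) else u e)).real (openConn dd b) ≤ (prodBernoulli (fun e : Sym2 (Fin n) => if (∃ y ∈ e, y ∈ ({x'} : Finset (Fin n))) then (0 : unitInterval) else u e)).real (openConn a b)) →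
        (prodBernoulli (fun e : Sym2 (Fin n) => if (∀ y ∈ e, y ∈ S) ∧ ¬ e.IsDiag then 1 else u e)).real (openConn dd b) < (prodBernoulli (fun e : Sym2 (Fin n) => if (∀ y ∈ e, y ∈ S) ∧ ¬ e.IsDiag then 1 else u e)).real (openConn a₀ b)) →
      ∃ x' ∈ S, ∃ (d : Finset (Fin n) → Fin n) (w : Finset (Fin n) → Sym2 (Fin n) → unitInterval) (modeB : Finset (Fin n) → Bool),
      (∀ B : Finset (Fin n), d B ∈ A) ∧
      (∀ B : Finset (Fin n), Disjoint (S.erase x' ∪ B) A → (prodBernoulli u).real {ω : BondConfig (Fin n) | ∀ y : Fin n, y ∈ B ↔ (y ∉ ({x'} : Finset (Fin n)) ∧ ∃ o ∈ ({x'} : Finset (Fin n)), s(o, y) ∈ ω)} ≠ 0 →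
        ∀ a ∈ A, (prodBernoulli (w B)).real (openConn (d B) b) ≤ (prodBernoulli (w B)).real (openConn a b)) ∧
      (∀ B : Finset (Fin n), Disjoint (S.erase x' ∪ B) A → (prodBernoulli u).real {ω : BondConfig (Fin n) | ∀ y : Fin n, y ∈ B ↔ (y ∉ ({x'} : Finset (Fin n)) ∧ ∃ o ∈ ({x'} : Finset (Fin n)), s(o, y) ∈ ω)} ≠ 0 →
        (Finset.univ.filter (fun v : Fin n => ∃ y : Fin n, 0 < (w B s(y, v) : ℝ))).card
          < (Finset.univ.filter (fun v : Fin n => ∃ y : Fin n, 0 < (u s(y, v) : ℝ))).card) ∧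
      (∀ B : Finset (Fin n), Disjoint (S.erase x' ∪ B) A → (prodBernoulli u).real {ω : BondConfig (Fin n) | ∀ y : Fin n, y ∈ B ↔ (y ∉ ({x'} : Finset (Fin n)) ∧ ∃ o ∈ ({x'} : Finset (Fin n)), s(o, y) ∈ ω)} ≠ 0 → ∀ e : Sym2 (Fin n),
        ¬ ((∀ y ∈ e, y ∈ (S.erase x' ∪ B)) ∧ ¬ e.IsDiag) → ¬ (d B ∈ e ∧ ∃ y ∈ e, y ∈ (S.erase x' ∪ B)) →
        w B e = (if modeB B = true then (fun e : Sym2 (Fin n) => if a₀ ∈ e ∧ (∃ y ∈ e, y ∈ (S.erase x' ∪ B)) then (0 : unitInterval) else if (∀ y ∈ e, y ∈ B) ∧ ¬ e.IsDiag then 1 else if (∃ y ∈ e, y ∈ ({x'} : Finset (Fin n))) then 0 else u e) e else (fun e : Sym2 (Fin n) => if (∀ y ∈ e, y ∈ B) ∧ ¬ e.IsDiag then 1 else if (∃ y ∈ e, y ∈ ({x'} : Finset (Fin n))) then 0 else u e) e)) ∧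
      (∀ B : Finset (Fin n), Disjoint (S.erase x' ∪ B) A → (prodBernoulli u).real {ω : BondConfig (Fin n) | ∀ y : Fin n, y ∈ B ↔ (y ∉ ({x'} : Finset (Fin n)) ∧ ∃ o ∈ ({x'} : Finset (Fin n)), s(o, y) ∈ ω)} ≠ 0 →
        0 < (prodBernoulli (w B)).real {ω : BondConfig (Fin n) | ∀ y ∈ (S.erase x' ∪ B), s(d B, y) ∉ ω}) ∧
      0 ≤ ∑ B : Finset (Fin n), (prodBernoulli u).real {ω : BondConfig (Fin n) | ∀ y : Fin n, y ∈ B ↔ (y ∉ ({x'} : Finset (Fin n)) ∧ ∃ o ∈ ({x'} : Finset (Fin n)), s(o, y) ∈ ω)}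
          * (if Disjoint (S.erase x' ∪ B) A then
              (if modeB B = true then
                  (prodBernoulli (fun e : Sym2 (Fin n) => if (∀ y ∈ e, y ∈ B) ∧ ¬ e.IsDiag then 1 else if (∃ y ∈ e, y ∈ ({x'} : Finset (Fin n))) then 0 else u e)).real {ω : BondConfig (Fin n) | ∀ y ∈ (S.erase x' ∪ B), s(a₀, y) ∉ ω}
                    * (((prodBernoulli (fun e : Sym2 (Fin n) => if a₀ ∈ e ∧ (∃ y ∈ e, y ∈ (S.erase x' ∪ B)) then (0 : unitInterval) else if (∀ y ∈ e, y ∈ B) ∧ ¬ e.IsDiag then 1 else if (∃ y ∈ e, y ∈ ({x'} : Finset (Fin n))) then 0 else u e)).real (openConn (d B) b) + (prodBernoulli (fun e : Sym2 (Fin n) => if a₀ ∈ e ∧ (∃ y ∈ e, y ∈ (S.erase x' ∪ B)) then (0 : unitInterval) else if (∀ y ∈ e, y ∈ B) ∧ ¬ e.IsDiag then 1 else if (∃ y ∈ e, y ∈ ({x'} : Finset (Fin n))) then 0 else u e)).real ((openConn (d B) b)ᶜ ∩ (⋃ v ∈ (S.erase x' ∪ B), openConn (d B) v) ∩ (⋃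 v ∈ (S.erase x' ∪ B), openConn v b)))
                       - ((prodBernoulli (fun e : Sym2 (Fin n) => if a₀ ∈ e ∧ (∃ y ∈ e, y ∈ (S.erase x' ∪ B)) then (0 : unitInterval) else if (∀ y ∈ e, y ∈ B) ∧ ¬ e.IsDiag then 1 else if (∃ y ∈ e, y ∈ ({x'} : Finset (Fin n))) then 0 else u e)).real (openConn a₀ b) + (prodBernoulli (fun e : Sym2 (Fin n) => if a₀ ∈ e ∧ (∃ y ∈ e, y ∈ (S.erase x' ∪ B)) then (0 : unitInterval) else if (∀ y ∈ e, y ∈ B) ∧ ¬ e.IsDiag then 1 else if (∃ y ∈ e, y ∈ ({x'} : Finset (Fin n))) then 0 else u e)).real ((openConn a₀ b)ᶜ ∩ (⋃ v ∈ (S.erase x' ∪ B), openConn a₀ v) ∩ (⋃ v ∈ (S.erase x' ∪ B), openConn v b))))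
                else (((prodBernoulli (fun e : Sym2 (Fin n) => if (∀ y ∈ e, y ∈ B) ∧ ¬ e.IsDiag then 1 else if (∃ y ∈ e, y ∈ ({x'} : Finset (Fin n))) then 0 else u e)).real (openConn (d B) b) + (prodBernoulli (fun e : Sym2 (Fin n) => if (∀ y ∈ e, y ∈ B) ∧ ¬ e.IsDiag then 1 else if (∃ y ∈ e, y ∈ ({x'} : Finset (Fin n))) then 0 else u e)).real ((openConn (d B) b)ᶜ ∩ (⋃ v ∈ (S.erase x' ∪ B), openConn (d B) v) ∩ (⋃ v ∈ (S.erase x' ∪ B), openConn v b)))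
                       - ((prodBernoulli (fun e : Sym2 (Fin n) => if (∀ y ∈ e, y ∈ B) ∧ ¬ e.IsDiag then 1 else if (∃ y ∈ e, y ∈ ({x'} : Finset (Fin n))) then 0 else u e)).real (openConn a₀ b) + (prodBernoulli (fun e : Sym2 (Fin n) => if (∀ y ∈ e, y ∈ B) ∧ ¬ e.IsDiag then 1 else if (∃ y ∈ e, y ∈ ({x'} : Finset (Fin n))) then 0 else u e)).real ((openConn a₀ b)ᶜ ∩ (⋃ v ∈ (S.erase x' ∪ B), openConn a₀ v) ∩ (⋃ v ∈ (S.erase x' ∪ B), openConn v b)))))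
            else
              ((prodBernoulli (fun e : Sym2 (Fin n) => if (∀ y ∈ e, y ∈ B) ∧ ¬ e.IsDiag then 1 else if (∃ y ∈ e, y ∈ ({x'} : Finset (Fin n))) then 0 else u e)).real (⋃ v ∈ (S.erase x' ∪ B), openConn v b)
                - ((prodBernoulli (fun e : Sym2 (Fin n) => if (∀ y ∈ e, y ∈ B) ∧ ¬ e.IsDiag then 1 else if (∃ y ∈ e, y ∈ ({x'} : Finset (Fin n))) then 0 else u e)).real (openConn a₀ b) + (prodBernoulli (fun e : Sym2 (Fin n) => if (∀ y ∈ e, y ∈ B) ∧ ¬ e.IsDiag then 1 else if (∃ y ∈ e, y ∈ ({x'} : Finset (Fin n))) then 0 else u e)).real ((openConn a₀ b)ᶜ ∩ (⋃ v ∈ (S.erase x' ∪ B), openConn a₀ v) ∩ (⋃ v ∈ (S.erase x' ∪ B), openConn v b))))))) :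
    ∀ (n : ℕ) (w : Sym2 (Fin n) → unitInterval) (A : Finset (Fin n)) (o b : Fin n) (t : ℝ), 0 ≤ t →
      (∀ a ∈ A, 1 - t ≤ (prodBernoulli w).real (openConn a b)) →
      (prodBernoulli w).real (⋃ a ∈ A, openConn o a) - t ≤ (prodBernoulli w).real (openConn o b) :=
  stub_cone7Assembly_c5 (cone7_of_gdmCert hG)

end GDMReduction

end

end Summit.CriticalPhenomena.PercolationContinuityZ3.Theorems
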